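import Literature.Probability.RandomPlanarGeometry.LoewnerDriverUniformStability
import Literature.Probability.RandomPlanarGeometry.LoewnerMapProofs
import Literature.Probability.RandomPlanarGeometry.LoewnerHullCapacity
import Literature.Probability.RandomPlanarGeometry.HullHausdorffCapacity
import HarnessLib

/-!
# `stub_hullHausdorff` — Hausdorff convergence of the closed Loewner hulls under uniform
convergence of the drivers (crux `PathUpgradeR`, stmt-CriticalPhenomena-18055, line `bidir_windows`)

**Theorem.** Let `W n → V` uniformly on `[0, T]` (`T > 0`, all drivers continuous), let the chain
of `V` be generated by a SIMPLE curve `γ` (injective, in `ℍ` at positive times, `γ 0 = V 0`), and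
let no real point other than `V 0` be swallowed by time `T`. Then
`hausdorffDist (closure K_T(W n)) (γ[0, T]) → 0`.

**Proof.** *Upper half* (`eventually_hull_subset_thickening`): Kemppainen–Smirnov's Lemma 5.4
(`Loewner.eventually_disjoint_hull_of_tendstoUniformlyOn_driving`) applied to the compact set of
points of `ℍ̄ ∩ B̄(0, R)` that are `ε`-off `γ[0, T]`, all of which flow beyond `T` for `V` (off `ℝ`
because `K_T(V) = γ(0, T]`, on `ℝ` by hypothesis); `R` is the a-priori radius of
`Loewner.hull_subset_closedBall_driving`. *Lower half*, pointwise at `y = γ t₀`, `0 < t₀ ≤ T`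
(`eventually_exists_mem_hull_near`): split `γ[0, T] ∖ B(y, ε)` into the initial arc
`P = γ[0, t₁]`, `t₁ < t₀`, and a compact final arc `Q ⊆ ℍ` at positive distance from `P`
(`exists_split`). If `K_T(W n) ⊆ (γ[0, T])^δ` missed `B(y, ε)`, then, `K̂_T ∪ {im ≤ 0}` being
connected (`Loewner.closedHull_subset_of_closed_cover`), the hull would lie in `closure P^δ`
(`hull_subset_of_closed_cover`), whence `2T = hcap K_T(W n) ≤ hcap Fill(closure P^δ)` (Lawler's
(3.8), `hcap_mono`); but `hcap Fill(closure P^δ) → hcap Fill(P) = hcap K_{t₁}(V) = 2 t₁ < 2T` as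
`δ → 0` (Kemppainen–Smirnov's Lemma A.2 `tendsto_hcap_of_thickening`, `Loewner.hcap_hull_eq`;
`exists_hcap_fill_lt`). *Assembly*: a finite `ε/2`-net of the compact arc and
`Metric.hausdorffDist_le_of_mem_dist`. References: G. F. Lawler, *Conformally Invariant Processes
in the Plane* (2005), Prop. 4.47, (3.8); A. Kemppainen, S. Smirnov, Ann. Probab. 45 (2017), App. A.
[folklore]
-/

noncomputable section

open Set Filter Metric Topology Bornology
open scoped NNReal
open UpperHalfPlane (upperHalfPlaneSet isOpen_upperHalfPlaneSet)

namespace Summit.CriticalPhenomena.SAWScalingLimit.Theorems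

open Literature.Probability.RandomPlanarGeometry Literature.Probability.RandomPlanarGeometry.Loewner

namespace PathUpgradeRHullHausdorff

/-! ### Upper half: approximating hulls stay near the limit arc -/

/-- **Approximating hulls stay in every neighbourhood of the limit arc** (Kemppainen–Smirnov
Lemma 5.4 applied to the compact set of points `ε`-off the arc in the a-priori disc). [folklore] -/
theorem eventually_hull_subset_thickening {W : ℕ → ℝ≥0 → ℝ} {V : ℝ≥0 → ℝ} {γ : ℝ≥0 → ℂ}
    {T : ℝ≥0} (hW : ∀ n, Continuous (W n)) (hV : Continuous V) (hgen : IsGeneratedByCurve V γ)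
    (hs : IsSimpleTrace γ)
    (hreal : ∀ x : ℝ, x ≠ V 0 → (T : WithTop ℝ≥0) < swallowingTime V (x : ℂ))
    (hconv : TendstoUniformlyOn W V atTop (Icc 0 T)) {ε : ℝ} (hε : 0 < ε) :
    ∀ᶠ n in atTop, hull (W n) T ⊆ thickening ε (γ '' Icc 0 T) := by
  -- a uniform bound on the limit driver on `[0, T]`; eventually the drivers are `1`-close
  obtain ⟨C, hC⟩ := (isCompact_Icc : IsCompact (Icc (0 : ℝ≥0) T)).exists_bound_of_continuousOn
    hV.continuousOn
  have h1 : ∀ᶠ n in atTop, ∀ s ∈ Icc (0 : ℝ≥0) T, dist (V s) (W n s) < 1 :=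
    (Metric.tendstoUniformlyOn_iff.1 hconv) 1 one_pos
  -- the compact set of points `ε`-off the arc inside the a-priori disc flows beyond `T` for `V`
  set R : ℝ := ((2 * C + 2) + 4 * Real.sqrt T) + (C + 1) with hR
  set Z : Set ℂ := (closedBall (0 : ℂ) R ∩ {z : ℂ | 0 ≤ z.im}) \ thickening ε (γ '' Icc 0 T)
    with hZ
  have hZc : IsCompact Z :=
    ((isCompact_closedBall _ _).inter_right
      (isClosed_le continuous_const Complex.continuous_im)).diff isOpen_thickening
  have hsub : γ '' Icc 0 T ⊆ thickening ε (γ '' Icc 0 T) := self_subset_thickening hε _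
  have hZflow : ∀ z ∈ Z, (T : WithTop ℝ≥0) < swallowingTime V z := by
    rintro z ⟨⟨-, hzim⟩, hzth⟩
    have hzim' : 0 ≤ z.im := hzim
    rcases hzim'.eq_or_lt with h0 | hpos
    · -- a real point other than `V 0 = γ 0`
      have hz : z = ((z.re : ℝ) : ℂ) := Complex.ext (by simp) (by simp [← h0])
      rw [hz]
      refine hreal z.re fun heq ↦ hzth (hsub ⟨0, left_mem_Icc.2 zero_le, ?_⟩)
      rw [hz, heq, hgen.apply_zero]
    · -- a point of `ℍ` off the hull `K_T(V) = γ(0, T]`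
      by_contra hle
      have hmem : z ∈ hull V T := ⟨hpos, not_lt.1 hle⟩
      rw [hgen.hull_eq_image hs T] at hmem
      obtain ⟨s, hs', rfl⟩ := hmem
      exact hzth (hsub ⟨s, ⟨hs'.1.le, hs'.2⟩, rfl⟩)
  -- Kemppainen–Smirnov 5.4: eventually `Z` misses the approximating hulls
  have hconv' : TendstoUniformlyOn (fun n (s : ℝ≥0) => W n s) V atTop (Iic T) :=
    hconv.mono fun s hs => ⟨zero_le, hs⟩
  have hdisj := eventually_disjoint_hull_of_tendstoUniformlyOn_driving hV (Eventually.of_forall hW)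
    hconv' hZc hZflow
  filter_upwards [hdisj, h1] with n hn hn1
  intro z hz
  by_contra hzth
  -- the a-priori radius: `K_T(W n) ⊆ B̄(W n 0, 2C + 2 + 4√T) ⊆ B̄(0, R)`
  have hWs : ∀ s ∈ Icc (0 : ℝ≥0) T, |W n s| ≤ C + 1 := fun s hs' ↦ by
    have hd := hn1 s hs'
    rw [Real.dist_eq] at hd
    have hVs : |V s| ≤ C := by simpa [Real.norm_eq_abs] using hC s hs'
    linarith [abs_sub_abs_le_abs_sub (W n s) (V s), abs_sub_comm (W n s) (V s)]
  have hS : ∀ s : ℝ≥0, s ≤ T → |W n s - W n 0| ≤ 2 * C + 2 := fun s hs' ↦ by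
    linarith [abs_sub (W n s) (W n 0), hWs s ⟨zero_le, hs'⟩, hWs 0 ⟨zero_le, zero_le⟩]
  have hball : hull (W n) T ⊆ closedBall (0 : ℂ) R := by
    refine (hull_subset_closedBall_driving (hW n) hS).trans (closedBall_subset_closedBall' ?_)
    rw [hR, dist_zero_right, Complex.norm_real, Real.norm_eq_abs]
    linarith [hWs 0 ⟨zero_le, zero_le⟩]
  have hzpos : 0 < z.im := hz.1
  have hzim : z ∈ {z : ℂ | 0 ≤ z.im} := le_of_lt hzpos
  exact (Set.disjoint_left.1 hn) ⟨⟨hball hz, hzim⟩, hzth⟩ hz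

/-- **No floating pieces.** If the hull `K_t` of a continuous driving function is covered by two
disjoint closed sets `P`, `F` with `F ⊆ ℍ`, then `K_t ⊆ P`: otherwise `K̂_t ∩ F` would be a clopen
piece of the connected set `K̂_t ∪ {im ≤ 0}` (`Loewner.closedHull_subset_of_closed_cover`).
[folklore] -/
theorem hull_subset_of_closed_cover {W : ℝ≥0 → ℝ} (hW : Continuous W) {t : ℝ≥0} {P F : Set ℂ}
    (hP : IsClosed P) (hF : IsClosed F) (hPF : Disjoint P F) (hFH : F ⊆ upperHalfPlaneSet)
    (hcov : hull W t ⊆ P ∪ F) : hull W t ⊆ P := by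
  have hLc : IsClosed {z : ℂ | z.im ≤ 0} := isClosed_le Complex.continuous_im continuous_const
  have hsub : closedHull W t ⊆ P ∪ {z : ℂ | z.im ≤ 0} := by
    refine closedHull_subset_of_closed_cover hW (hP.union hLc) hF ?_ ?_ subset_union_right
    · rintro z (hz | hz)
      · rcases mem_closedHull_iff.1 hz with h | h
        · exact (hcov h).imp_left Or.inl
        · exact Or.inl (Or.inr (le_of_eq h.1))
      · exact Or.inl (Or.inr hz)
    · refine Set.eq_empty_iff_forall_notMem.2 ?_
      rintro z ⟨-, (hzP | hzL), hzF⟩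
      · exact Set.disjoint_left.1 hPF hzP hzF
      · exact absurd (show 0 < z.im from hFH hzF) (not_lt.2 hzL)
  exact fun z hz ↦ (hsub (hull_subset_closedHull W t hz)).elim id fun h ↦
    absurd (show 0 < z.im from hull_subset W t hz) (not_lt.2 h)

/-- **Splitting the arc.** For a simple curve `γ`, a time `t₀ > 0` and `ε > 0`, there are `t₁ < t₀`
and `δ₀ > 0` such that for every `δ ∈ (0, δ₀]` the points `δ`-close to `γ[0, T]` but `ε`-far from
`γ t₀` are `δ`-close to the initial arc `γ[0, t₁]` or lie in a closed set `F ⊆ ℍ` disjoint from the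
closed `δ`-neighbourhood of that arc (`F` = closed `δ`-neighbourhood of a final arc
`γ[t₂, T] ⊆ ℍ`, compact and disjoint from `γ[0, t₁]` by injectivity). [folklore] -/
theorem exists_split {γ : ℝ≥0 → ℂ} (hγ : Continuous γ) (hs : IsSimpleTrace γ) (T : ℝ≥0)
    {t₀ : ℝ≥0} (ht₀ : 0 < t₀) {ε : ℝ} (hε : 0 < ε) :
    ∃ t₁ : ℝ≥0, t₁ < t₀ ∧ ∃ δ₀ : ℝ, 0 < δ₀ ∧ ∀ δ : ℝ, 0 < δ → δ ≤ δ₀ →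
      ∃ F : Set ℂ, IsClosed F ∧ F ⊆ upperHalfPlaneSet ∧
        Disjoint (cthickening δ (γ '' Icc 0 t₁)) F ∧
        thickening δ (γ '' Icc 0 T) \ ball (γ t₀) ε ⊆ thickening δ (γ '' Icc 0 t₁) ∪ F := by
  -- times near `t₀` are mapped into `B(γ t₀, ε / 2)`
  have hnhds : ∀ᶠ s in 𝓝 t₀, dist (γ s) (γ t₀) < ε / 2 :=
    Metric.tendsto_nhds.1 (hγ.tendsto t₀) (ε / 2) (half_pos hε)
  obtain ⟨t₁, ht₁, hIoc⟩ := exists_Ioc_subset_of_mem_nhds hnhds ⟨0, ht₀⟩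
  obtain ⟨t₂, ht₂, hIco⟩ := exists_Ico_subset_of_mem_nhds hnhds ⟨t₀ + 1, lt_add_one t₀⟩
  have hPc : IsCompact (γ '' Icc 0 t₁) := isCompact_Icc.image hγ
  have hQc : IsCompact (γ '' Icc t₂ T) := isCompact_Icc.image hγ
  have hPQ : Disjoint (γ '' Icc 0 t₁) (γ '' Icc t₂ T) := by
    refine Set.disjoint_left.2 ?_
    rintro _ ⟨a, ha, rfl⟩ ⟨b, hb, hab⟩
    rw [hs.1 hab] at hb
    exact absurd (hb.1.trans ha.2) (not_le.2 (ht₁.trans ht₂))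
  have hQH : γ '' Icc t₂ T ⊆ upperHalfPlaneSet := by
    rintro _ ⟨b, hb, rfl⟩
    exact hs.2 b ((ht₀.trans ht₂).trans_le hb.1)
  obtain ⟨δ₁, hδ₁, hdisj⟩ := hPQ.exists_cthickenings hPc hQc.isClosed
  obtain ⟨δ₂, hδ₂, hQ₂⟩ := hQc.exists_cthickening_subset_open isOpen_upperHalfPlaneSet hQH
  refine ⟨t₁, ht₁, min (min δ₁ δ₂) (ε / 2), lt_min (lt_min hδ₁ hδ₂) (half_pos hε),
    fun δ _ hδle ↦ ?_⟩
  have hδ₁' : δ ≤ δ₁ := hδle.trans ((min_le_left _ _).trans (min_le_left _ _))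
  have hδ₂' : δ ≤ δ₂ := hδle.trans ((min_le_left _ _).trans (min_le_right _ _))
  refine ⟨cthickening δ (γ '' Icc t₂ T), isClosed_cthickening, (cthickening_mono hδ₂' _).trans hQ₂,
    hdisj.mono (cthickening_mono hδ₁' _) (cthickening_mono hδ₁' _), ?_⟩
  rintro z ⟨hz, hzb⟩
  obtain ⟨_, ⟨u, hu, rfl⟩, hzu⟩ := mem_thickening_iff.1 hz
  by_cases hu₁ : u ≤ t₁
  · exact Or.inl (mem_thickening_iff.2 ⟨γ u, ⟨u, ⟨hu.1, hu₁⟩, rfl⟩, hzu⟩)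
  by_cases hu₂ : t₂ ≤ u
  · exact Or.inr (thickening_subset_cthickening δ _
      (mem_thickening_iff.2 ⟨γ u, ⟨u, ⟨hu₂, hu.2⟩, rfl⟩, hzu⟩))
  have hclose : dist (γ u) (γ t₀) < ε / 2 := by
    rcases le_or_gt u t₀ with h | h
    · exact hIoc ⟨not_le.1 hu₁, h⟩
    · exact hIco ⟨h.le, not_le.1 hu₂⟩
  refine (hzb (mem_ball.2 ?_)).elim
  calc dist z (γ t₀) ≤ dist z (γ u) + dist (γ u) (γ t₀) := dist_triangle _ _ _
    _ < δ + ε / 2 := add_lt_add hzu hclose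
    _ ≤ ε := by linarith [hδle.trans (min_le_right _ _)]

/-! ### Capacities: monotonicity, and the fills of thin neighbourhoods of an initial arc -/

/-- **Monotonicity of the half-plane capacity** (Lawler (2005), (3.8)): if `ℍ ∖ K₂ ⊆ ℍ ∖ K₁` for
hulls bounded in `ℍ` with hydrodynamically normalized maps, then `hcap K₁ ≤ hcap K₂` (additivity
`IsHydrodynamicMap.hcap_diffQuotient` and nonnegativity of the capacity of the quotient hull).
[folklore] -/
theorem hcap_mono {K₁ K₂ : Set ℂ} {φ₁ : ConformalEquiv (upperHalfPlaneSet \ K₁) upperHalfPlaneSet}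
    {φ₂ : ConformalEquiv (upperHalfPlaneSet \ K₂) upperHalfPlaneSet}
    (h₁ : IsHydrodynamicMap K₁ φ₁) (h₂ : IsHydrodynamicMap K₂ φ₂)
    (hb₁ : IsBounded (K₁ ∩ upperHalfPlaneSet)) (hb₂ : IsBounded (K₂ ∩ upperHalfPlaneSet))
    (h12 : upperHalfPlaneSet \ K₂ ⊆ upperHalfPlaneSet \ K₁) : hcap K₁ φ₁ ≤ hcap K₂ φ₂ := by
  have hq := h₁.hcap_diffQuotient h₂ hb₁ hb₂ h12
  have hnn := (h₁.diffQuotient h₂ hb₁ h12).hcap_nonneg (h₁.isBounded_diffImage hb₁ hb₂)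
  rw [hq] at hnn
  linarith

/-- A preconnected set containing the (real) starting point `γ 0 = V 0` of a generating curve,
together with the lower half-plane, is connected. [folklore] -/
theorem isConnected_union_im_nonpos {V : ℝ≥0 → ℝ} {γ : ℝ≥0 → ℂ} (hgen : IsGeneratedByCurve V γ)
    {S : Set ℂ} (hS : IsPreconnected S) (h0 : γ 0 ∈ S) :
    IsConnected (S ∪ {z : ℂ | z.im ≤ 0}) := by
  have h0L : γ 0 ∈ {z : ℂ | z.im ≤ 0} := by
    show (γ 0).im ≤ 0
    rw [hgen.apply_zero, Complex.ofReal_im]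
  exact ⟨⟨γ 0, Or.inl h0⟩, hS.union (γ 0) h0 h0L (convex_halfSpace_im_le 0).isPreconnected⟩

/-- **Fills of thin neighbourhoods of a proper initial arc have small capacity**: if `2 t₁ < c`,
some `δ ∈ (0, δ₀]` has `hcap Fill(closure (γ[0, t₁])^δ) < c`. Indeed along `δ_n → 0` these fills
carry hydrodynamically normalized maps (`exists_isHydrodynamicMap_hpFill`: the neighbourhoods are
closed, bounded and attached to `ℝ`) and `hcap Fill(closure (γ[0, t₁])^{δ_n}) → hcap Fill(γ[0, t₁])`
(Kemppainen–Smirnov Lemma A.2, `tendsto_hcap_of_thickening`), while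
`hcap Fill(γ[0, t₁]) = hcap K_{t₁}(V) = 2 t₁` (`Loewner.hcap_hull_eq`; the fill of the arc and the
hull of the generated chain have the same complement in `ℍ`). [folklore] -/
theorem exists_hcap_fill_lt {V : ℝ≥0 → ℝ} {γ : ℝ≥0 → ℂ} (hV : Continuous V)
    (hgen : IsGeneratedByCurve V γ) (t₁ : ℝ≥0) {δ₀ : ℝ} (hδ₀ : 0 < δ₀) {c : ℝ}
    (hc : 2 * (t₁ : ℝ) < c) :
    ∃ δ : ℝ, 0 < δ ∧ δ ≤ δ₀ ∧ ∃ φ : ConformalEquiv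
        (upperHalfPlaneSet \ hpFill (closure (thickening δ (γ '' Icc 0 t₁)))) upperHalfPlaneSet,
      IsHydrodynamicMap (hpFill (closure (thickening δ (γ '' Icc 0 t₁)))) φ ∧
        hcap (hpFill (closure (thickening δ (γ '' Icc 0 t₁)))) φ < c := by
  have hPc : IsCompact (γ '' Icc 0 t₁) := isCompact_Icc.image hgen.continuous
  have hPconn : IsPreconnected (γ '' Icc 0 t₁) :=
    isPreconnected_Icc.image _ hgen.continuous.continuousOn
  have h0P : γ 0 ∈ γ '' Icc 0 t₁ := ⟨0, ⟨le_rfl, zero_le⟩, rfl⟩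
  -- the scales `δ n = min δ₀ 1 / (n + 1)`
  set δ : ℕ → ℝ := fun n ↦ min δ₀ 1 / ((n : ℝ) + 1) with hδ
  have hδpos : ∀ n, 0 < δ n := fun n ↦ by positivity
  have hδle : ∀ n, δ n ≤ min δ₀ 1 := fun n ↦
    div_le_self (by positivity) (by linarith [(n.cast_nonneg : (0 : ℝ) ≤ n)])
  have hδ0 : Tendsto δ atTop (𝓝 0) := by
    have h := (tendsto_one_div_add_atTop_nhds_zero_nat (𝕜 := ℝ)).const_mul (min δ₀ 1)
    rw [mul_zero] at h
    exact h.congr fun n ↦ by simp only [hδ]; ring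
  -- the fills of the neighbourhoods and of the arc, with their hydrodynamic maps
  have hSb : ∀ n, IsBounded (closure (thickening (δ n) (γ '' Icc 0 t₁))) := fun n ↦
    hPc.isBounded.thickening.closure
  choose φn hφn using fun n ↦ exists_isHydrodynamicMap_hpFill isClosed_closure (hSb n)
    (isConnected_union_im_nonpos hgen ((isPreconnected_thickening hPconn (hδpos n)).closure)
      (subset_closure (self_subset_thickening (hδpos n) _ h0P)))
  obtain ⟨φ, hφ⟩ := exists_isHydrodynamicMap_hpFill hPc.isClosed hPc.isBounded
    (isConnected_union_im_nonpos hgen hPconn h0P)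
  have hVeq : upperHalfPlaneSet \ hpFill (γ '' Icc 0 t₁) =
      unboundedComponent (upperHalfPlaneSet \ γ '' Icc 0 t₁) :=
    diff_hpFill hPc.isClosed hPc.isBounded
  -- a common radius
  obtain ⟨R₀, hR₀⟩ := hPc.isBounded.subset_closedBall 0
  have hSR : γ '' Icc 0 t₁ ⊆ closedBall (0 : ℂ) (|R₀| + 2) :=
    hR₀.trans (closedBall_subset_closedBall (by linarith [le_abs_self R₀]))
  have hSnR : ∀ n, closure (thickening (δ n) (γ '' Icc 0 t₁)) ⊆ closedBall (0 : ℂ) (|R₀| + 2) := by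
    intro n z hz
    obtain ⟨p, hp, hzp⟩ := mem_thickening_iff.1 (cthickening_subset_thickening' two_pos
      ((hδle n).trans_lt ((min_le_right _ _).trans_lt one_lt_two)) _
      (closure_thickening_subset_cthickening _ _ hz))
    have hpR : dist p 0 ≤ R₀ := hR₀ hp
    rw [mem_closedBall]
    linarith [dist_triangle z p 0, le_abs_self R₀]
  -- Kemppainen–Smirnov A.2
  have key := tendsto_hcap_of_thickening (S := γ '' Icc 0 t₁) (K := hpFill (γ '' Icc 0 t₁))
    (φ := φ) (Sn := fun n ↦ closure (thickening (δ n) (γ '' Icc 0 t₁)))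
    (Kn := fun n ↦ hpFill (closure (thickening (δ n) (γ '' Icc 0 t₁)))) (φn := φn)
    (by positivity) hSR hSnR hVeq (fun n ↦ diff_hpFill isClosed_closure (hSb n)) hφ hφn
    (fun ε hε ↦ (hδ0.eventually (eventually_lt_nhds hε)).mono fun n hn ↦
      (closure_thickening_subset_cthickening _ _).trans (cthickening_subset_thickening' hε hn _))
    (fun ε hε ↦ Eventually.of_forall fun n z hz ↦
      self_subset_thickening hε _ (subset_closure (self_subset_thickening (hδpos n) _ hz)))
  -- identify the limit: `hcap Fill(γ[0, t₁]) = hcap K_{t₁}(V) = 2 t₁`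
  obtain ⟨ψ, hψ⟩ := exists_conformalEquiv_map_holds hV t₁
  have hψh : IsHydrodynamicMap (hull V t₁) ψ := isHydrodynamicMap_of_eqOn hV t₁ hψ
  have hdiff : upperHalfPlaneSet \ hpFill (γ '' Icc 0 t₁) = upperHalfPlaneSet \ hull V t₁ := by
    rw [hVeq, hgen.hull_eq t₁, Set.sdiff_sdiff_right_self,
      inter_eq_right.2 ((unboundedComponent_subset _).trans Set.sdiff_subset)]
  have hb : IsBounded (hpFill (γ '' Icc 0 t₁) ∩ upperHalfPlaneSet) :=
    (isBounded_hpFill hPc.isBounded).subset inter_subset_left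
  have hb' : IsBounded (hull V t₁ ∩ upperHalfPlaneSet) :=
    (isBounded_closedHull hV t₁).subset (inter_subset_left.trans (hull_subset_closedHull _ _))
  have heq : hcap (hpFill (γ '' Icc 0 t₁)) φ = 2 * t₁ := by
    rw [← hcap_hull_eq hV t₁ hψ]
    exact le_antisymm (hcap_mono hφ hψh hb hb' hdiff.symm.subset)
      (hcap_mono hψh hφ hb' hb hdiff.subset)
  rw [heq] at key
  obtain ⟨m, hm⟩ := (key.eventually (eventually_lt_nhds hc)).exists
  exact ⟨δ m, hδpos m, (hδle m).trans (min_le_left _ _), φn m, hφn m, hm⟩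

/-! ### Lower half, pointwise and then uniformly on the arc -/

/-- **The approximating hulls come close to every point `γ t₀`, `0 < t₀ ≤ T`, of the arc.** If not,
for the small `δ` of `exists_hcap_fill_lt` the hull `K_T(W n) ⊆ (γ[0, T])^δ` (upper half) would miss
`B(γ t₀, ε)`, hence (`exists_split`, `hull_subset_of_closed_cover`) lie in `closure (γ[0, t₁])^δ`
with `t₁ < t₀`, and `2T = hcap K_T(W n) ≤ hcap Fill(closure (γ[0, t₁])^δ) < 2T` (`hcap_mono`,
`Loewner.hcap_hull_eq`). [folklore] -/
theorem eventually_exists_mem_hull_near {W : ℕ → ℝ≥0 → ℝ} {V : ℝ≥0 → ℝ} {γ : ℝ≥0 → ℂ}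
    {T : ℝ≥0} (hW : ∀ n, Continuous (W n)) (hV : Continuous V) (hgen : IsGeneratedByCurve V γ)
    (hs : IsSimpleTrace γ)
    (hreal : ∀ x : ℝ, x ≠ V 0 → (T : WithTop ℝ≥0) < swallowingTime V (x : ℂ))
    (hconv : TendstoUniformlyOn W V atTop (Icc 0 T)) {t₀ : ℝ≥0} (ht₀ : 0 < t₀) (ht₀T : t₀ ≤ T)
    {ε : ℝ} (hε : 0 < ε) :
    ∀ᶠ n in atTop, ∃ z ∈ hull (W n) T, dist z (γ t₀) < ε := by
  obtain ⟨t₁, ht₁, δ₀, hδ₀, hsplit⟩ := exists_split hgen.continuous hs T ht₀ hε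
  have h2 : 2 * (t₁ : ℝ) < 2 * T := by
    linarith [show (t₁ : ℝ) < T by exact_mod_cast ht₁.trans_le ht₀T]
  obtain ⟨δ, hδ, hδle, φ, hφ, hlt⟩ := exists_hcap_fill_lt hV hgen t₁ hδ₀ h2
  -- the upper half at scale `δ`
  filter_upwards [eventually_hull_subset_thickening hW hV hgen hs hreal hconv hδ] with n hn
  by_contra hfar
  push Not at hfar
  obtain ⟨F, hFc, hFH, hdisj, hcover⟩ := hsplit δ hδ hδle
  -- the hull sits in the closed neighbourhood of the initial arc
  have hKS : hull (W n) T ⊆ closure (thickening δ (γ '' Icc 0 t₁)) := by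
    refine hull_subset_of_closed_cover (hW n) isClosed_closure hFc
      (hdisj.mono_left (closure_thickening_subset_cthickening _ _)) hFH fun z hz ↦ ?_
    have hz' : z ∈ thickening δ (γ '' Icc 0 T) \ ball (γ t₀) ε :=
      ⟨hn hz, fun hb ↦ (hfar z hz).not_gt (mem_ball.1 hb)⟩
    rcases hcover hz' with h | h
    · exact Or.inl (subset_closure h)
    · exact Or.inr h
  -- capacity comparison: `2T = hcap K_T(W n) ≤ hcap Fill(closure (γ[0, t₁])^δ) < 2T`
  obtain ⟨ψ, hψ⟩ := exists_conformalEquiv_map_holds (hW n) T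
  have hb₁ : IsBounded (hull (W n) T ∩ upperHalfPlaneSet) :=
    (isBounded_closedHull (hW n) T).subset (inter_subset_left.trans (hull_subset_closedHull _ _))
  have hb₂ : IsBounded (hpFill (closure (thickening δ (γ '' Icc 0 t₁))) ∩ upperHalfPlaneSet) :=
    (isBounded_hpFill (isCompact_Icc.image hgen.continuous).isBounded.thickening.closure).subset
      inter_subset_left
  have hmono := hcap_mono (isHydrodynamicMap_of_eqOn (hW n) T hψ) hφ hb₁ hb₂ fun z hz ↦
    ⟨hz.1, fun hzK ↦ hz.2 (inter_subset_hpFill _ ⟨hKS hzK, hz.1⟩)⟩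
  rw [hcap_hull_eq (hW n) T hψ] at hmono
  exact absurd (hmono.trans_lt hlt) (lt_irrefl _)

/-- **Uniform lower half**: eventually every point of `γ[0, T]` is within `ε` of `K_T(W n)` — the
pointwise statement at the centres of a finite `ε/2`-net of the compact arc (the endpoint `γ 0`
being approached through a positive time). [folklore] -/
theorem eventually_forall_exists_mem_hull_near {W : ℕ → ℝ≥0 → ℝ} {V : ℝ≥0 → ℝ} {γ : ℝ≥0 → ℂ}
    {T : ℝ≥0} (hT : 0 < T) (hW : ∀ n, Continuous (W n)) (hV : Continuous V)
    (hgen : IsGeneratedByCurve V γ) (hs : IsSimpleTrace γ)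
    (hreal : ∀ x : ℝ, x ≠ V 0 → (T : WithTop ℝ≥0) < swallowingTime V (x : ℂ))
    (hconv : TendstoUniformlyOn W V atTop (Icc 0 T)) {ε : ℝ} (hε : 0 < ε) :
    ∀ᶠ n in atTop, ∀ t ∈ Icc (0 : ℝ≥0) T, ∃ z ∈ hull (W n) T, dist z (γ t) < ε := by
  -- pointwise, at every time of `[0, T]`
  have hpt : ∀ t ∈ Icc (0 : ℝ≥0) T, ∀ᶠ n in atTop, ∃ z ∈ hull (W n) T, dist z (γ t) < ε / 2 := by
    intro t ht
    obtain ⟨t', ht'0, ht'T, hd⟩ :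
        ∃ t' : ℝ≥0, 0 < t' ∧ t' ≤ T ∧ dist (γ t') (γ t) < ε / 4 := by
      rcases (zero_le : 0 ≤ t).eq_or_lt with h0 | hpos
      · subst h0
        have hc : ∀ᶠ s in 𝓝 (0 : ℝ≥0), dist (γ s) (γ 0) < ε / 4 :=
          Metric.tendsto_nhds.1 (hgen.continuous.tendsto 0) _ (by positivity)
        obtain ⟨u, hu0, hu⟩ := exists_Ico_subset_of_mem_nhds hc ⟨T, hT⟩
        refine ⟨min T (u / 2), lt_min hT (half_pos hu0), min_le_left _ _, hu ⟨zero_le, ?_⟩⟩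
        exact (min_le_right _ _).trans_lt (half_lt_self hu0)
      · exact ⟨t, hpos, ht.2, by rw [dist_self]; positivity⟩
    filter_upwards [eventually_exists_mem_hull_near hW hV hgen hs hreal hconv ht'0 ht'T
      (ε := ε / 4) (by positivity)] with n ⟨z, hz, hzd⟩
    exact ⟨z, hz, by linarith [dist_triangle z (γ t') (γ t)]⟩
  -- a finite `ε / 2`-net of the arc
  obtain ⟨N, hNA, hNf, hcov⟩ :=
    finite_cover_balls_of_compact (isCompact_Icc.image hgen.continuous : IsCompact (γ '' Icc 0 T))
      (half_pos hε)
  have hnet : ∀ᶠ n in atTop, ∀ x ∈ N, ∃ z ∈ hull (W n) T, dist z x < ε / 2 := by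
    refine (eventually_all_finite hNf).2 fun x hx ↦ ?_
    obtain ⟨t, ht, rfl⟩ := hNA hx
    exact hpt t ht
  filter_upwards [hnet] with n hn t ht
  obtain ⟨x, hxN, hx⟩ := mem_iUnion₂.1 (hcov ⟨t, ht, rfl⟩)
  obtain ⟨z, hz, hzx⟩ := hn x hxN
  refine ⟨z, hz, ?_⟩
  have hx' : dist x (γ t) < ε / 2 := by rw [dist_comm]; exact mem_ball.1 hx
  linarith [dist_triangle z x (γ t)]

end PathUpgradeRHullHausdorff

open PathUpgradeRHullHausdorff in
/-- **Hausdorff convergence of the closed Loewner hulls (Kemppainen–Smirnov Lemma 5.4 upgraded at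
chains generated by a simple curve).** If `W n → V` uniformly on `[0, T]`, the chain of `V` is
generated by the simple curve `γ` and no real point other than `V 0` is swallowed by time `T`, then
`hausdorffDist (closure K_T(W n)) (γ[0, T]) → 0`: both one-sided bounds
(`eventually_hull_subset_thickening`, `eventually_forall_exists_mem_hull_near`) and
`Metric.hausdorffDist_le_of_mem_dist`. [folklore] -/
theorem stub_hullHausdorff : ∀ (W : ℕ → NNReal → ℝ) (V : NNReal → ℝ) (γ : NNReal → ℂ) (T : NNReal), 0 < T → (∀ n, Continuous (W n)) → Continuous V → Literature.Probability.RandomPlanarGeometry.Loewner.IsGeneratedByCurve V γ → Literature.Probability.RandomPlanarGeometry.Loewner.IsSimpleTrace γ → (∀ x : ℝ, x ≠ V 0 → (T : WithTop NNReal) < Literature.Probability.RandomPlanarGeometry.Loewner.swallowingTime V (x : ℂ)) → TendstoUniformlyOn W V Filter.atTop (Set.Icc 0 T) → Filter.Tendsto (fun n => Metric.hausdorffDist (closure (Literature.Probability.RandomPlanarGeometry.Loewner.hull (W n) T)) (γ '' Set.Icc 0 T)) Filter.atTop (nhds 0) := by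
  intro W V γ T hT hW hV hgen hs hreal hconv
  rw [Metric.tendsto_nhds]
  intro ε hε
  have hA : IsCompact (γ '' Icc 0 T) := isCompact_Icc.image hgen.continuous
  filter_upwards [eventually_hull_subset_thickening hW hV hgen hs hreal hconv (half_pos hε),
    eventually_forall_exists_mem_hull_near hT hW hV hgen hs hreal hconv (half_pos hε)] with n h1 h2
  rw [Real.dist_eq, sub_zero, abs_of_nonneg hausdorffDist_nonneg]
  refine lt_of_le_of_lt (hausdorffDist_le_of_mem_dist (half_pos hε).le ?_ ?_) (half_lt_self hε)
  · intro x hx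
    have hx' : x ∈ cthickening (ε / 2) (γ '' Icc 0 T) :=
      closure_thickening_subset_cthickening _ _ (closure_mono h1 hx)
    rw [hA.cthickening_eq_biUnion_closedBall (half_pos hε).le] at hx'
    obtain ⟨y, hy, hxy⟩ := mem_iUnion₂.1 hx'
    exact ⟨y, hy, mem_closedBall.1 hxy⟩
  · rintro _ ⟨t, ht, rfl⟩
    obtain ⟨z, hz, hzd⟩ := h2 t ht
    exact ⟨z, subset_closure hz, by rw [dist_comm]; exact hzd.le⟩

end Summit.CriticalPhenomena.SAWScalingLimit.Theorems

end
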